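import Mathlib

/-!
# `WeightedInvariant.LocalWeightedDrop`, line `hasse-ridge-face-selection`, S3ρ sub-stub S3ρD `stub_wildMonicSurfaceDescent`: item D-0
# «maximising flag» — X-ADIC CAUCHY LIMITS of chains of coordinate changes (the input `hcomplete` of the limit kernel)

Crux item stmt-ResolutionOfSingularities-8899 `LocalWeightedDrop` (route `ResolutionOfSingularities/WeightedInvariant`), engine of the door
`HypersurfaceCentreConstruction` stmt-ResolutionOfSingularities-19897.  [OURS · L1 W4.3, chain w43, res-L1-w43-stub-3 (gen 3) on roadmap item
D-0 of `L/res-L1-w43-stub-7/S3RHOD-ROADMAP.md` (owners res-type-083 / stub-7); spec `L/res-L1-w43-stub-3/D0-SPEC.md` §5 (D-0d).  MODEL: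
Perlega, arXiv:2011.14443 Ch. 5 §3, proof of Prop. 5.3.5 `maximum_over_y_and_z_exists` (p0066 L60 – p0067 L40): an unbounded chain of cleanings
`(g_i, h_i)` has `ord G_i, ord H_i → ∞`, "so `G̃_k = Σ_{i ≥ k} G_i` and `H̃_k` are well-defined power series" — the COMPLETENESS STEP, which
res-D-pv-056 AS stub-5's abstract kernel `WildMonic.exists_isGreatest_of_complete` (`…WildMonicMaxFlagLimit`) takes as its hypothesis
`hcomplete`, and which Hauser–Perlega's curve-flag proof inlines (`HauserPerlega2024.exists_inf_rows_eq_top_or_bounded`, the series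
`φ_∞`).  Folklore (`k⟦x⟧`, `k⟦x₀, x₁⟧` are complete for the `(x)`-adic / weighted topologies); stated coefficientwise so that the
level-`M` smallness may be ANY level-monotone set of negligible monomials (plain order, a fixed weighted order, or the consumer's
level-dependent line weights).  Mathlib-only, definition-free.]

* `coeff_sub_eq_zero_of_chain` — consecutive smallness propagates along the chain (ultrametric bookkeeping);
* **`exists_forall_coeff_sub_eq_zero_of_chain`** — THE LIMIT: for levels `N j ↑ ∞` and a chain `c` with `c (j+1) − c j` negligible at
  level `N j`, a series `g` with `g − c j` negligible at level `N j` for EVERY `j` (coefficientwise eventual value);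
* instances: `exists_forall_le_weightedOrder_sub_of_chain` (a fixed weighted order on `MvPowerSeries σ R`),
  `exists_forall_le_order_sub_of_chain` (total order), `PowerSeries.`-valued `exists_forall_le_order_sub_of_chain₁`; each with a
  `₀` companion recording that a chain of series without constant term has a limit without constant term.
-/

set_option linter.dupNamespace false -- mandated namespace of this single-conjunct summit

namespace Summit.ResolutionOfSingularities.ResolutionOfSingularities.Theorems

namespace WildMonic

open MvPowerSeries

section Abstract

variable {σ : Type*} {R : Type*} [Ring R]

/-- Ultrametric bookkeeping along a chain: if `c (i+1) − c i` has no monomials below level `N i` for every `i`, the levels are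
non-decreasing and the set of monomials below a level grows with the level, then `c j' − c j` has no monomials below level `N j`
for all `j ≤ j'`. [cite: Perlega2020, Prop. 5.3.5 proof (arXiv:2011.14443 Ch. 5 §3, p0067 L10–L30)] -/
theorem coeff_sub_eq_zero_of_chain (Below : ℕ → (σ →₀ ℕ) → Prop)
    (hmono : ∀ {M M' : ℕ} {e : σ →₀ ℕ}, M ≤ M' → Below M e → Below M' e)
    (c : ℕ → MvPowerSeries σ R) (N : ℕ → ℕ) (hN : Monotone N)
    (hstep : ∀ j (e : σ →₀ ℕ), Below (N j) e → coeff e (c (j + 1) - c j) = 0)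
    {j j' : ℕ} (hjj' : j ≤ j') {e : σ →₀ ℕ} (he : Below (N j) e) : coeff e (c j' - c j) = 0 := by
  induction j', hjj' using Nat.le_induction with
  | base => rw [sub_self, map_zero]
  | succ j' hjj' ih =>
    rw [← sub_add_sub_cancel (c (j' + 1)) (c j') (c j), map_add, ih, add_zero]
    exact hstep j' e (hmono (hN hjj') he)

/-- **THE `(x)`-ADIC LIMIT OF A CAUCHY CHAIN** (coefficientwise form).  Let `Below M e` ("the monomial `e` is negligible at level `M`")
grow with `M` and exhaust all monomials, let the levels `N j` be non-decreasing and unbounded, and let `c` be a chain with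
`c (j+1) − c j` negligible at level `N j`.  Then there is a series `g` — the coefficientwise eventual value of the chain — with `g − c j`
negligible at level `N j` for EVERY `j`: "`G̃_k = Σ_{i ≥ k} G_i` is a well-defined power series".
[cite: Perlega2020, Prop. 5.3.5 proof (arXiv:2011.14443 Ch. 5 §3, p0067 L10–L40); HauserPerlega2024, Prop. 3 proof p. 792 l. 14–30 (`y_∞`)] -/
theorem exists_forall_coeff_sub_eq_zero_of_chain (Below : ℕ → (σ →₀ ℕ) → Prop)
    (hmono : ∀ {M M' : ℕ} {e : σ →₀ ℕ}, M ≤ M' → Below M e → Below M' e) (hexh : ∀ e : σ →₀ ℕ, ∃ M, Below M e)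
    (c : ℕ → MvPowerSeries σ R) (N : ℕ → ℕ) (hN : Monotone N) (hNtop : ∀ M, ∃ j, M ≤ N j)
    (hstep : ∀ j (e : σ →₀ ℕ), Below (N j) e → coeff e (c (j + 1) - c j) = 0) :
    ∃ g : MvPowerSeries σ R, ∀ j (e : σ →₀ ℕ), Below (N j) e → coeff e (g - c j) = 0 := by
  classical
  choose M hM using hexh
  choose J hJ using hNtop
  -- `j₀ e := J (M e)`: an index from which on the coefficient of `e` is constant along the chain
  have hj₀ : ∀ e, Below (N (J (M e))) e := fun e => hmono (hJ (M e)) (hM e)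
  let g : MvPowerSeries σ R := fun e => coeff e (c (J (M e)))
  have hg : ∀ e, coeff e g = coeff e (c (J (M e))) := fun _ => rfl
  refine ⟨g, fun j e he => ?_⟩
  rw [map_sub, hg, ← map_sub]
  rcases le_total j (J (M e)) with h | h
  · exact coeff_sub_eq_zero_of_chain Below hmono c N hN hstep h he
  · rw [← neg_sub, map_neg, coeff_sub_eq_zero_of_chain Below hmono c N hN hstep h (hj₀ e), neg_zero]

/-- `exists_forall_coeff_sub_eq_zero_of_chain` for chains WITHOUT CONSTANT TERMS: if moreover every `c j` has constant coefficient `0`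
and the constant monomial is negligible at some level of the chain, the limit has constant coefficient `0` (coordinate changes stay
coordinate changes in the limit). [cite: Perlega2020, Prop. 5.3.5 proof (arXiv:2011.14443 Ch. 5 §3, p0067 L30–L40)] -/
theorem exists_forall_coeff_sub_eq_zero_of_chain₀ (Below : ℕ → (σ →₀ ℕ) → Prop)
    (hmono : ∀ {M M' : ℕ} {e : σ →₀ ℕ}, M ≤ M' → Below M e → Below M' e) (hexh : ∀ e : σ →₀ ℕ, ∃ M, Below M e)
    (c : ℕ → MvPowerSeries σ R) (N : ℕ → ℕ) (hN : Monotone N) (hNtop : ∀ M, ∃ j, M ≤ N j)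
    (hstep : ∀ j (e : σ →₀ ℕ), Below (N j) e → coeff e (c (j + 1) - c j) = 0)
    (h0 : ∀ j, constantCoeff (c j) = 0) (h1 : ∃ j, Below (N j) 0) :
    ∃ g : MvPowerSeries σ R, constantCoeff g = 0 ∧ ∀ j (e : σ →₀ ℕ), Below (N j) e → coeff e (g - c j) = 0 := by
  obtain ⟨g, hg⟩ := exists_forall_coeff_sub_eq_zero_of_chain Below hmono hexh c N hN hNtop hstep
  obtain ⟨j, hj⟩ := h1
  refine ⟨g, ?_, hg⟩
  have h2 := hg j 0 hj
  rw [map_sub, sub_eq_zero, coeff_zero_eq_constantCoeff_apply, coeff_zero_eq_constantCoeff_apply, h0 j] at h2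
  exact h2

end Abstract

/-! ### Instances: a fixed weighted order, the total order, one variable -/

section Weighted

variable {σ : Type*} {R : Type*} [Ring R]

/-- **Completeness of `R⟦σ⟧` for a weighted order.**  A chain `c` with `N j ≤ ord_w (c (j+1) − c j)`, levels `N` non-decreasing and
unbounded, has a limit `g` with `N j ≤ ord_w (g − c j)` for every `j` (any weight `w : σ → ℕ`, zero weights allowed).
[cite: Perlega2020, Prop. 5.3.5 proof (arXiv:2011.14443 Ch. 5 §3, p0067 L10–L40)] -/
theorem exists_forall_le_weightedOrder_sub_of_chain (w : σ → ℕ) (c : ℕ → MvPowerSeries σ R) (N : ℕ → ℕ) (hN : Monotone N)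
    (hNtop : ∀ M, ∃ j, M ≤ N j) (hstep : ∀ j, (N j : ℕ∞) ≤ (c (j + 1) - c j).weightedOrder w) :
    ∃ g : MvPowerSeries σ R, ∀ j, (N j : ℕ∞) ≤ (g - c j).weightedOrder w := by
  obtain ⟨g, hg⟩ := exists_forall_coeff_sub_eq_zero_of_chain (fun M e => Finsupp.weight w e < M)
    (fun hMM' h => lt_of_lt_of_le h hMM') (fun e => ⟨Finsupp.weight w e + 1, Nat.lt_succ_self _⟩) c N hN hNtop
    (fun j e he => coeff_eq_zero_of_lt_weightedOrder w (lt_of_lt_of_le (by exact_mod_cast he) (hstep j)))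
  exact ⟨g, fun j => nat_le_weightedOrder w fun e he => hg j e (by exact_mod_cast he)⟩

/-- `exists_forall_le_weightedOrder_sub_of_chain` for chains of series without constant term, some level being positive: the limit has
no constant term. [cite: Perlega2020, Prop. 5.3.5 proof (arXiv:2011.14443 Ch. 5 §3, p0067 L30–L40)] -/
theorem exists_forall_le_weightedOrder_sub_of_chain₀ (w : σ → ℕ) (c : ℕ → MvPowerSeries σ R) (N : ℕ → ℕ) (hN : Monotone N)
    (hNtop : ∀ M, ∃ j, M ≤ N j) (hstep : ∀ j, (N j : ℕ∞) ≤ (c (j + 1) - c j).weightedOrder w)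
    (h0 : ∀ j, constantCoeff (c j) = 0) (h1 : ∃ j, 0 < N j) :
    ∃ g : MvPowerSeries σ R, constantCoeff g = 0 ∧ ∀ j, (N j : ℕ∞) ≤ (g - c j).weightedOrder w := by
  obtain ⟨j₁, hj₁⟩ := h1
  obtain ⟨g, hg0, hg⟩ := exists_forall_coeff_sub_eq_zero_of_chain₀ (fun M e => Finsupp.weight w e < M)
    (fun hMM' h => lt_of_lt_of_le h hMM') (fun e => ⟨Finsupp.weight w e + 1, Nat.lt_succ_self _⟩) c N hN hNtop
    (fun j e he => coeff_eq_zero_of_lt_weightedOrder w (lt_of_lt_of_le (by exact_mod_cast he) (hstep j))) h0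
    ⟨j₁, by simpa only [map_zero] using hj₁⟩
  exact ⟨g, hg0, fun j => nat_le_weightedOrder w fun e he => hg j e (by exact_mod_cast he)⟩

/-- **Completeness of `R⟦σ⟧` for the total order**: a chain with `N j ≤ ord (c (j+1) − c j)`, `N ↑ ∞`, has a limit `g` with
`N j ≤ ord (g − c j)` for every `j`. [cite: Perlega2020, Prop. 5.3.5 proof (arXiv:2011.14443 Ch. 5 §3, p0067 L10–L40)] -/
theorem exists_forall_le_order_sub_of_chain (c : ℕ → MvPowerSeries σ R) (N : ℕ → ℕ) (hN : Monotone N)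
    (hNtop : ∀ M, ∃ j, M ≤ N j) (hstep : ∀ j, (N j : ℕ∞) ≤ (c (j + 1) - c j).order) :
    ∃ g : MvPowerSeries σ R, ∀ j, (N j : ℕ∞) ≤ (g - c j).order := by
  obtain ⟨g, hg⟩ := exists_forall_coeff_sub_eq_zero_of_chain (fun M e => Finsupp.degree e < M)
    (fun hMM' h => lt_of_lt_of_le h hMM') (fun e => ⟨Finsupp.degree e + 1, Nat.lt_succ_self _⟩) c N hN hNtop
    (fun j e he => coeff_of_lt_order (lt_of_lt_of_le (by exact_mod_cast he) (hstep j)))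
  exact ⟨g, fun j => nat_le_order fun e he => hg j e (by exact_mod_cast he)⟩

/-- `exists_forall_le_order_sub_of_chain` for chains of series without constant term, some level being positive.
[cite: Perlega2020, Prop. 5.3.5 proof (arXiv:2011.14443 Ch. 5 §3, p0067 L30–L40)] -/
theorem exists_forall_le_order_sub_of_chain₀ (c : ℕ → MvPowerSeries σ R) (N : ℕ → ℕ) (hN : Monotone N)
    (hNtop : ∀ M, ∃ j, M ≤ N j) (hstep : ∀ j, (N j : ℕ∞) ≤ (c (j + 1) - c j).order)
    (h0 : ∀ j, constantCoeff (c j) = 0) (h1 : ∃ j, 0 < N j) :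
    ∃ g : MvPowerSeries σ R, constantCoeff g = 0 ∧ ∀ j, (N j : ℕ∞) ≤ (g - c j).order := by
  obtain ⟨j₁, hj₁⟩ := h1
  obtain ⟨g, hg0, hg⟩ := exists_forall_coeff_sub_eq_zero_of_chain₀ (fun M e => Finsupp.degree e < M)
    (fun hMM' h => lt_of_lt_of_le h hMM') (fun e => ⟨Finsupp.degree e + 1, Nat.lt_succ_self _⟩) c N hN hNtop
    (fun j e he => coeff_of_lt_order (lt_of_lt_of_le (by exact_mod_cast he) (hstep j))) h0
    ⟨j₁, by simpa only [map_zero] using hj₁⟩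
  exact ⟨g, hg0, fun j => nat_le_order fun e he => hg j e (by exact_mod_cast he)⟩

end Weighted

section OneVariable

variable {R : Type*} [Ring R]

/-- **Completeness of `R⟦x⟧`** (the limit shear `y_∞ = y + Σ (h_{i+1} − h_i)`): a chain `c` of one-variable series with
`N j ≤ ord (c (j+1) − c j)`, `N ↑ ∞`, has a limit `φ` with `N j ≤ ord (φ − c j)` for every `j`.
[cite: HauserPerlega2024, Prop. 3 proof p. 792 l. 14–30; Perlega2020, Prop. 5.3.5 proof (arXiv:2011.14443 Ch. 5 §3, p0067 L10–L40)] -/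
theorem exists_forall_le_order_sub_of_chain₁ (c : ℕ → PowerSeries R) (N : ℕ → ℕ) (hN : Monotone N)
    (hNtop : ∀ M, ∃ j, M ≤ N j) (hstep : ∀ j, (N j : ℕ∞) ≤ (c (j + 1) - c j).order) :
    ∃ φ : PowerSeries R, ∀ j, (N j : ℕ∞) ≤ (φ - c j).order := by
  obtain ⟨g, hg⟩ := exists_forall_coeff_sub_eq_zero_of_chain (σ := Unit) (R := R) (fun M e => e () < M)
    (fun hMM' h => lt_of_lt_of_le h hMM') (fun e => ⟨e () + 1, Nat.lt_succ_self _⟩) c N hN hNtop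
    (fun j e he => by
      change MvPowerSeries.coeff e (c (j + 1) - c j) = 0
      rw [← PowerSeries.coeff_def (s := e) rfl]
      exact PowerSeries.coeff_of_lt_order _ (lt_of_lt_of_le (by exact_mod_cast he) (hstep j)))
  refine ⟨g, fun j => PowerSeries.nat_le_order _ _ fun i hi => ?_⟩
  rw [PowerSeries.coeff_def (s := Finsupp.single () i) Finsupp.single_eq_same]
  exact hg j _ (by rwa [Finsupp.single_eq_same])

/-- `exists_forall_le_order_sub_of_chain₁` for chains of shears (no constant term), some level being positive: the limit is a shear.
[cite: HauserPerlega2024, Prop. 3 proof p. 792 l. 14–30] -/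
theorem exists_forall_le_order_sub_of_chain₁₀ (c : ℕ → PowerSeries R) (N : ℕ → ℕ) (hN : Monotone N)
    (hNtop : ∀ M, ∃ j, M ≤ N j) (hstep : ∀ j, (N j : ℕ∞) ≤ (c (j + 1) - c j).order)
    (h0 : ∀ j, PowerSeries.constantCoeff (c j) = 0) (h1 : ∃ j, 0 < N j) :
    ∃ φ : PowerSeries R, PowerSeries.constantCoeff φ = 0 ∧ ∀ j, (N j : ℕ∞) ≤ (φ - c j).order := by
  obtain ⟨φ, hφ⟩ := exists_forall_le_order_sub_of_chain₁ c N hN hNtop hstep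
  obtain ⟨j, hj⟩ := h1
  refine ⟨φ, ?_, hφ⟩
  have h2 := PowerSeries.coeff_of_lt_order 0 (lt_of_lt_of_le (by exact_mod_cast hj) (hφ j))
  rw [map_sub, sub_eq_zero, PowerSeries.coeff_zero_eq_constantCoeff_apply, PowerSeries.coeff_zero_eq_constantCoeff_apply, h0 j] at h2
  exact h2

/-- Levels indexed by a strictly increasing function are non-decreasing and unbounded — the form in which the limit kernel
`WildMonic.exists_isGreatest_of_complete` (hypothesis `hcomplete`, `StrictMono N`) calls the lemmas above. -/
theorem monotone_and_unbounded_of_strictMono {N : ℕ → ℕ} (hN : StrictMono N) : Monotone N ∧ ∀ M, ∃ j, M ≤ N j :=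
  ⟨hN.monotone, fun M => ⟨M, hN.le_apply⟩⟩

end OneVariable

/-! ### The limit without the exhaustion hypothesis -/

section AbstractPartial

variable {σ : Type*} {R : Type*} [Ring R]

/-- `exists_forall_coeff_sub_eq_zero_of_chain` WITHOUT THE EXHAUSTION HYPOTHESIS: monomials that are negligible at no level (for the
consumer's level-dependent line weights: monomials on or above every `s`-line) are simply given limit coefficient `0`; on all other
monomials the limit is the coefficientwise eventual value of the chain.  So a chain supported away from a set of never-negligible
monomials has a limit supported away from it. [cite: Perlega2020, Prop. 5.3.5 proof (arXiv:2011.14443 Ch. 5 §3, p0067 L10–L40)] -/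
theorem exists_forall_coeff_sub_eq_zero_of_chain' (Below : ℕ → (σ →₀ ℕ) → Prop)
    (hmono : ∀ {M M' : ℕ} {e : σ →₀ ℕ}, M ≤ M' → Below M e → Below M' e)
    (c : ℕ → MvPowerSeries σ R) (N : ℕ → ℕ) (hN : Monotone N) (hNtop : ∀ M, ∃ j, M ≤ N j)
    (hstep : ∀ j (e : σ →₀ ℕ), Below (N j) e → coeff e (c (j + 1) - c j) = 0) :
    ∃ g : MvPowerSeries σ R, (∀ e : σ →₀ ℕ, (∀ M, ¬ Below M e) → coeff e g = 0) ∧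
      ∀ j (e : σ →₀ ℕ), Below (N j) e → coeff e (g - c j) = 0 := by
  classical
  choose J hJ using hNtop
  let g : MvPowerSeries σ R := fun e => if h : ∃ M, Below M e then coeff e (c (J h.choose)) else 0
  refine ⟨g, fun e he => ?_, fun j e he => ?_⟩
  · show (if h : ∃ M, Below M e then coeff e (c (J h.choose)) else 0) = 0
    rw [dif_neg (not_exists.mpr he)]
  · have hex : ∃ M, Below M e := ⟨N j, he⟩
    have hg : coeff e g = coeff e (c (J hex.choose)) := by
      show (if h : ∃ M, Below M e then coeff e (c (J h.choose)) else 0) = _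
      rw [dif_pos hex]
    have hj₀ : Below (N (J hex.choose)) e := hmono (hJ _) hex.choose_spec
    rw [map_sub, hg, ← map_sub]
    rcases le_total j (J hex.choose) with h | h
    · exact coeff_sub_eq_zero_of_chain Below hmono c N hN hstep h he
    · rw [← neg_sub, map_neg, coeff_sub_eq_zero_of_chain Below hmono c N hN hstep h hj₀, neg_zero]

/-- `exists_forall_coeff_sub_eq_zero_of_chain'` for chains without constant terms, the constant monomial negligible at some level.
[cite: Perlega2020, Prop. 5.3.5 proof (arXiv:2011.14443 Ch. 5 §3, p0067 L30–L40)] -/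
theorem exists_forall_coeff_sub_eq_zero_of_chain'₀ (Below : ℕ → (σ →₀ ℕ) → Prop)
    (hmono : ∀ {M M' : ℕ} {e : σ →₀ ℕ}, M ≤ M' → Below M e → Below M' e)
    (c : ℕ → MvPowerSeries σ R) (N : ℕ → ℕ) (hN : Monotone N) (hNtop : ∀ M, ∃ j, M ≤ N j)
    (hstep : ∀ j (e : σ →₀ ℕ), Below (N j) e → coeff e (c (j + 1) - c j) = 0)
    (h0 : ∀ j, constantCoeff (c j) = 0) (h1 : ∃ j, Below (N j) 0) :
    ∃ g : MvPowerSeries σ R, constantCoeff g = 0 ∧ (∀ e : σ →₀ ℕ, (∀ M, ¬ Below M e) → coeff e g = 0) ∧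
      ∀ j (e : σ →₀ ℕ), Below (N j) e → coeff e (g - c j) = 0 := by
  obtain ⟨g, hgz, hg⟩ := exists_forall_coeff_sub_eq_zero_of_chain' Below hmono c N hN hNtop hstep
  obtain ⟨j, hj⟩ := h1
  refine ⟨g, ?_, hgz, hg⟩
  have h2 := hg j 0 hj
  rw [map_sub, sub_eq_zero, coeff_zero_eq_constantCoeff_apply, coeff_zero_eq_constantCoeff_apply, h0 j] at h2
  exact h2

end AbstractPartial

end WildMonic

end Summit.ResolutionOfSingularities.ResolutionOfSingularities.Theorems
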